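import Summits.AnomalousDissipation.AnomalousDissipation.Theorems.SolenoidalFractalHomogenisationLagrangianStepCellChainFastEnergy
import HarnessLib

/-!
# K1L_D `LagrangianRenormalisationStepDesign` (stmt-AnomalousDissipation-27980), `stub_cellLawV0_IS` V0:
# BULK SLAVING OF THE FAST ENERGY of a weak solution of the flat tensor cell problem to a finite slow block
# (helper; `--supports stmt-AnomalousDissipation-27980`)

Summits-side helper file of route `SolenoidalFractalHomogenisation` (prover seat `ad-k1l-cellLawV-w1` g5).  Everything proved; no definitions,
no named facts, no sorry.  Continues `…CellChainFastEnergy` (setting and notation there: slow block `W`, gap `dmin`, fast energy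
`Z = E − Σ_{k∈W}‖y_k‖²`, exchange `X`).

* `ae_exchange_le` — when the chain neighbours `k ± Kⱼ` of the block lie OUTSIDE the block, a.e. on `(0,T)`:
  `X t ≤ (dmin/2)·Z t + (2/dmin)·A(t)²`, `A(t) := Σ_{k∈W} ‖y_k(t)‖·Σⱼ ‖linkCoeffⱼ(k,t)‖·(‖aⱼ‖ + ‖a′ⱼ‖)` (Cauchy–Schwarz, `‖P_k‖ ≤ 1`,
  `‖y_{k±Kⱼ}‖ ≤ √Z`, Young);
* **`fastEnergy_le`** — hence, with `A(t) ≤ A` on `[0,T]`: `Z t ≤ 4A²/dmin² + e^{−dmin t/2}·(Z 0 − 4A²/dmin²)` for all `t ∈ [0,T]`;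
* **`fastEnergy_le_of_zero`** — for a datum carried by the block (`Z 0 = 0`, e.g. the single slow mode `Re e_ℓ·p` with `W = {±ℓ}`):
  `Z t ≤ 4A²/dmin²`, i.e. `√Z ≤ 2A/dmin` — THE FAST ENERGY IS SLAVED IN BULK TO THE SLOW AMPLITUDES with the ratio (link strength)/(spectral gap);
  for the K1L cell problem `‖linkCoeffⱼ(ℓ,·)‖·‖aⱼ‖ ≤ |êⱼ·ℓ|/(2n|mⱼ|) = O(ϖν/K)` against `dmin = 8π²(ν lo/(Λn²))(n − ‖ℓ‖)² = O(ν)`: the ratio is `O(ϖ)`,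
  UNIFORMLY IN `ν` — no Galerkin truncation, no enhanced dissipation;
* `norm_sq_le_fastEnergy` — a single fast mode is below the fast energy everywhere on `[0,T]` (Parseval a.e. + continuity).
This is the a-priori input of every V0 assembly (Markov/quasi-static reduction of the slow equation, `‖x′‖ ≲ r̄‖x‖`; second-neighbour and
leftover-sideband bounds) on THE weak solution.  NOT a proof of any registered stub, of the crux, or of anomalous dissipation; rung F-D1.A0
infrastructure.
-/

set_option linter.dupNamespace false

noncomputable section

namespace Summit.AnomalousDissipation.AnomalousDissipation.Theorems.SolenoidalFractalHomogenisation.LagrangianStep.CellChain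

open Set MeasureTheory Filter Topology Function Complex UnitAddTorus
open scoped InnerProductSpace ComplexConjugate
open Literature.Analysis Literature.Analysis.FunctionSpaces Literature.Analysis.FunctionSpaces.Torus
open Literature.Analysis.FluidPDE Literature.Analysis.FluidPDE.Torus Literature.Analysis.FluidPDE.LatticeShear

variable {k₀ : ℕ}

/-! ## The exchange bound and the packaged slaving estimates -/

/-- **The exchange is controlled by the slow amplitudes times `√Z`.**  If the chain neighbours `k ± Kⱼ` of the block lie outside the block,
then for a.e. `t ∈ (0,T)`: `X t ≤ (dmin/2)·Z t + (2/dmin)·A(t)²`,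
`A(t) = Σ_{k∈W} ‖y_k(t)‖·Σⱼ ‖linkCoeffⱼ(k,t)‖(‖aⱼ‖ + ‖a′ⱼ‖)` (Cauchy–Schwarz, `‖P_k‖ ≤ 1`, `‖y_{k±Kⱼ}‖ ≤ √Z`, Young). [cite: BedrossianCotiZelati2017, §2] -/
theorem ae_exchange_le (W₁ : LatticeWord k₀) (n : ℕ) {T : ℝ} (hT : 0 ≤ T) {𝔹 : Torus.Visc4 (Fin 3)}
    {F : UnitAddTorus (Fin 3) → EuclideanSpace ℝ (Fin 3)} {u : ℝ → UnitAddTorus (Fin 3) → EuclideanSpace ℝ (Fin 3)}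
    (h : Torus.IsWeakTensorPassiveVectorOn 0 T 𝔹 (W₁.cell n) F u) (hF : Integrable F volume)
    {E : ℝ → ℝ} (hE : ∀ᵐ t ∂(volume.restrict (Ioo 0 T)), E t = ∫ x, ‖u t x‖ ^ 2)
    (W : Finset (Fin 3 → ℤ)) {dmin : ℝ} (hdmin : 0 < dmin)
    (hnb : ∀ k ∈ W, ∀ j : Fin k₀, (k - fun i => (W₁.phase j).m i * n) ∉ W ∧ (k + fun i => (W₁.phase j).m i * n) ∉ W) :
    ∀ᵐ t ∂(volume : Measure ℝ), t ∈ Ioo 0 T →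
      ∑ k ∈ W, 2 * (⟪modeRep W₁ n 𝔹 F u k t, (∑ j, linkCoeff W₁ n k j t • transversalProj k
              ((Complex.exp ((W₁.phase j).φ * Complex.I) * (1 / (2 * ((2 * Real.pi * ‖latticeVec (W₁.phase j).m‖ : ℝ) : ℂ) * Complex.I))) •
                  modeRep W₁ n 𝔹 F u (k - fun i => (W₁.phase j).m i * n) t +
                (starRingEnd ℂ (Complex.exp ((W₁.phase j).φ * Complex.I)) *
                    (-(1 / (2 * ((2 * Real.pi * ‖latticeVec (W₁.phase j).m‖ : ℝ) : ℂ) * Complex.I)))) •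
                  modeRep W₁ n 𝔹 F u (k + fun i => (W₁.phase j).m i * n) t))⟫_ℂ).re
        ≤ dmin / 2 * (E t - ∑ k ∈ W, ‖modeRep W₁ n 𝔹 F u k t‖ ^ 2) +
          2 / dmin * (∑ k ∈ W, (‖modeRep W₁ n 𝔹 F u k t‖ * ∑ j, ‖linkCoeff W₁ n k j t‖ *
            (‖Complex.exp ((W₁.phase j).φ * Complex.I) * (1 / (2 * ((2 * Real.pi * ‖latticeVec (W₁.phase j).m‖ : ℝ) : ℂ) * Complex.I))‖ +
             ‖starRingEnd ℂ (Complex.exp ((W₁.phase j).φ * Complex.I)) *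
                    (-(1 / (2 * ((2 * Real.pi * ‖latticeVec (W₁.phase j).m‖ : ℝ) : ℂ) * Complex.I)))‖))) ^ 2 := by
  classical
  have hrep := (ae_restrict_iff' measurableSet_Ioo).1 (ae_forall_eq_modeRep W₁ n hT h hF)
  have hE' := (ae_restrict_iff' measurableSet_Ioo).1 hE
  have hmem := (ae_restrict_iff' measurableSet_Ioo).1 h.ae_memLp_two
  filter_upwards [hrep, hE', hmem] with t hrept hEt hmemt htI
  set X : (Fin 3 → ℤ) → EuclideanSpace ℂ (Fin 3) := fun k => modeRep W₁ n 𝔹 F u k t with hX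
  set Z : ℝ := E t - ∑ k ∈ W, ‖X k‖ ^ 2 with hZ
  -- Parseval at time `t` and the single-mode bound off the block
  have hpars : HasSum (fun k => ‖X k‖ ^ 2) (E t) := by
    have hp := hasSum_sq_norm_mFourierCoeff_complexify (hmemt htI)
    rw [hEt htI]
    refine hp.congr_fun fun k => ?_
    simp only [hX, hrept htI k]
  have hoff : ∀ k', k' ∉ W → ‖X k'‖ ^ 2 ≤ Z := by
    intro k' hk'
    have h1 := sum_le_hasSum (insert k' W) (fun i _ => sq_nonneg ‖X i‖) hpars
    rw [Finset.sum_insert hk'] at h1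
    rw [hZ]; linarith
  have hZnn : 0 ≤ Z := by
    have h1 := sum_le_hasSum W (fun i _ => sq_nonneg ‖X i‖) hpars
    rw [hZ]; linarith
  have hoff' : ∀ k', k' ∉ W → ‖X k'‖ ≤ Real.sqrt Z := fun k' hk' => by
    rw [← Real.sqrt_sq (norm_nonneg (X k'))]
    exact Real.sqrt_le_sqrt (hoff k' hk')
  -- the norm of the link term of a block mode
  have hL : ∀ k ∈ W, ‖(∑ j, linkCoeff W₁ n k j t • transversalProj k
              ((Complex.exp ((W₁.phase j).φ * Complex.I) * (1 / (2 * ((2 * Real.pi * ‖latticeVec (W₁.phase j).m‖ : ℝ) : ℂ) * Complex.I))) •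
                  modeRep W₁ n 𝔹 F u (k - fun i => (W₁.phase j).m i * n) t +
                (starRingEnd ℂ (Complex.exp ((W₁.phase j).φ * Complex.I)) *
                    (-(1 / (2 * ((2 * Real.pi * ‖latticeVec (W₁.phase j).m‖ : ℝ) : ℂ) * Complex.I)))) •
                  modeRep W₁ n 𝔹 F u (k + fun i => (W₁.phase j).m i * n) t))‖ ≤ (∑ j, ‖linkCoeff W₁ n k j t‖ *
            (‖Complex.exp ((W₁.phase j).φ * Complex.I) * (1 / (2 * ((2 * Real.pi * ‖latticeVec (W₁.phase j).m‖ : ℝ) : ℂ) * Complex.I))‖ +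
             ‖starRingEnd ℂ (Complex.exp ((W₁.phase j).φ * Complex.I)) *
                    (-(1 / (2 * ((2 * Real.pi * ‖latticeVec (W₁.phase j).m‖ : ℝ) : ℂ) * Complex.I)))‖)) * Real.sqrt Z := by
    intro k hk
    rw [Finset.sum_mul]
    refine (norm_sum_le _ _).trans (Finset.sum_le_sum fun j _ => ?_)
    rw [norm_smul]
    have hm := (hnb k hk j).1
    have hp := (hnb k hk j).2
    have h1 := norm_transversalProj_le k
      ((Complex.exp ((W₁.phase j).φ * Complex.I) * (1 / (2 * ((2 * Real.pi * ‖latticeVec (W₁.phase j).m‖ : ℝ) : ℂ) * Complex.I))) •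
          modeRep W₁ n 𝔹 F u (k - fun i => (W₁.phase j).m i * n) t +
        (starRingEnd ℂ (Complex.exp ((W₁.phase j).φ * Complex.I)) *
            (-(1 / (2 * ((2 * Real.pi * ‖latticeVec (W₁.phase j).m‖ : ℝ) : ℂ) * Complex.I)))) •
          modeRep W₁ n 𝔹 F u (k + fun i => (W₁.phase j).m i * n) t)
    have h2 := norm_add_le
      ((Complex.exp ((W₁.phase j).φ * Complex.I) * (1 / (2 * ((2 * Real.pi * ‖latticeVec (W₁.phase j).m‖ : ℝ) : ℂ) * Complex.I))) •
          modeRep W₁ n 𝔹 F u (k - fun i => (W₁.phase j).m i * n) t)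
      ((starRingEnd ℂ (Complex.exp ((W₁.phase j).φ * Complex.I)) *
            (-(1 / (2 * ((2 * Real.pi * ‖latticeVec (W₁.phase j).m‖ : ℝ) : ℂ) * Complex.I)))) •
          modeRep W₁ n 𝔹 F u (k + fun i => (W₁.phase j).m i * n) t)
    rw [norm_smul, norm_smul] at h2
    have h3 := hoff' _ hm
    have h4 := hoff' _ hp
    have hc : 0 ≤ ‖linkCoeff W₁ n k j t‖ := norm_nonneg _
    have ha : 0 ≤ ‖Complex.exp ((W₁.phase j).φ * Complex.I) * (1 / (2 * ((2 * Real.pi * ‖latticeVec (W₁.phase j).m‖ : ℝ) : ℂ) * Complex.I))‖ :=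
      norm_nonneg _
    have ha' : 0 ≤ ‖starRingEnd ℂ (Complex.exp ((W₁.phase j).φ * Complex.I)) *
                    (-(1 / (2 * ((2 * Real.pi * ‖latticeVec (W₁.phase j).m‖ : ℝ) : ℂ) * Complex.I)))‖ := norm_nonneg _
    calc ‖linkCoeff W₁ n k j t‖ * ‖transversalProj k
          ((Complex.exp ((W₁.phase j).φ * Complex.I) * (1 / (2 * ((2 * Real.pi * ‖latticeVec (W₁.phase j).m‖ : ℝ) : ℂ) * Complex.I))) •
              modeRep W₁ n 𝔹 F u (k - fun i => (W₁.phase j).m i * n) t +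
            (starRingEnd ℂ (Complex.exp ((W₁.phase j).φ * Complex.I)) *
                (-(1 / (2 * ((2 * Real.pi * ‖latticeVec (W₁.phase j).m‖ : ℝ) : ℂ) * Complex.I)))) •
              modeRep W₁ n 𝔹 F u (k + fun i => (W₁.phase j).m i * n) t)‖
        ≤ ‖linkCoeff W₁ n k j t‖ *
            (‖Complex.exp ((W₁.phase j).φ * Complex.I) * (1 / (2 * ((2 * Real.pi * ‖latticeVec (W₁.phase j).m‖ : ℝ) : ℂ) * Complex.I))‖ * Real.sqrt Z +
             ‖starRingEnd ℂ (Complex.exp ((W₁.phase j).φ * Complex.I)) *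
                    (-(1 / (2 * ((2 * Real.pi * ‖latticeVec (W₁.phase j).m‖ : ℝ) : ℂ) * Complex.I)))‖ * Real.sqrt Z) := by
          refine mul_le_mul_of_nonneg_left (h1.trans (h2.trans (add_le_add ?_ ?_))) hc
          · exact mul_le_mul_of_nonneg_left h3 ha
          · exact mul_le_mul_of_nonneg_left h4 ha'
      _ = ‖linkCoeff W₁ n k j t‖ *
            (‖Complex.exp ((W₁.phase j).φ * Complex.I) * (1 / (2 * ((2 * Real.pi * ‖latticeVec (W₁.phase j).m‖ : ℝ) : ℂ) * Complex.I))‖ +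
             ‖starRingEnd ℂ (Complex.exp ((W₁.phase j).φ * Complex.I)) *
                    (-(1 / (2 * ((2 * Real.pi * ‖latticeVec (W₁.phase j).m‖ : ℝ) : ℂ) * Complex.I)))‖) * Real.sqrt Z := by ring
  -- each exchange term
  have hterm : ∀ k ∈ W, 2 * (⟪modeRep W₁ n 𝔹 F u k t, (∑ j, linkCoeff W₁ n k j t • transversalProj k
              ((Complex.exp ((W₁.phase j).φ * Complex.I) * (1 / (2 * ((2 * Real.pi * ‖latticeVec (W₁.phase j).m‖ : ℝ) : ℂ) * Complex.I))) •
                  modeRep W₁ n 𝔹 F u (k - fun i => (W₁.phase j).m i * n) t +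
                (starRingEnd ℂ (Complex.exp ((W₁.phase j).φ * Complex.I)) *
                    (-(1 / (2 * ((2 * Real.pi * ‖latticeVec (W₁.phase j).m‖ : ℝ) : ℂ) * Complex.I)))) •
                  modeRep W₁ n 𝔹 F u (k + fun i => (W₁.phase j).m i * n) t))⟫_ℂ).re ≤ 2 * Real.sqrt Z * (‖modeRep W₁ n 𝔹 F u k t‖ * ∑ j, ‖linkCoeff W₁ n k j t‖ *
            (‖Complex.exp ((W₁.phase j).φ * Complex.I) * (1 / (2 * ((2 * Real.pi * ‖latticeVec (W₁.phase j).m‖ : ℝ) : ℂ) * Complex.I))‖ +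
             ‖starRingEnd ℂ (Complex.exp ((W₁.phase j).φ * Complex.I)) *
                    (-(1 / (2 * ((2 * Real.pi * ‖latticeVec (W₁.phase j).m‖ : ℝ) : ℂ) * Complex.I)))‖)) := by
    intro k hk
    have h1 := re_inner_le_norm (𝕜 := ℂ) (modeRep W₁ n 𝔹 F u k t) (∑ j, linkCoeff W₁ n k j t • transversalProj k
              ((Complex.exp ((W₁.phase j).φ * Complex.I) * (1 / (2 * ((2 * Real.pi * ‖latticeVec (W₁.phase j).m‖ : ℝ) : ℂ) * Complex.I))) •
                  modeRep W₁ n 𝔹 F u (k - fun i => (W₁.phase j).m i * n) t +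
                (starRingEnd ℂ (Complex.exp ((W₁.phase j).φ * Complex.I)) *
                    (-(1 / (2 * ((2 * Real.pi * ‖latticeVec (W₁.phase j).m‖ : ℝ) : ℂ) * Complex.I)))) •
                  modeRep W₁ n 𝔹 F u (k + fun i => (W₁.phase j).m i * n) t))
    rw [RCLike.re_to_complex] at h1
    have h2 := mul_le_mul_of_nonneg_left (hL k hk) (norm_nonneg (modeRep W₁ n 𝔹 F u k t))
    have h3 := h1.trans h2
    have h4 : ‖modeRep W₁ n 𝔹 F u k t‖ * ((∑ j, ‖linkCoeff W₁ n k j t‖ *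
            (‖Complex.exp ((W₁.phase j).φ * Complex.I) * (1 / (2 * ((2 * Real.pi * ‖latticeVec (W₁.phase j).m‖ : ℝ) : ℂ) * Complex.I))‖ +
             ‖starRingEnd ℂ (Complex.exp ((W₁.phase j).φ * Complex.I)) *
                    (-(1 / (2 * ((2 * Real.pi * ‖latticeVec (W₁.phase j).m‖ : ℝ) : ℂ) * Complex.I)))‖)) * Real.sqrt Z)
        = Real.sqrt Z * (‖modeRep W₁ n 𝔹 F u k t‖ * ∑ j, ‖linkCoeff W₁ n k j t‖ *
            (‖Complex.exp ((W₁.phase j).φ * Complex.I) * (1 / (2 * ((2 * Real.pi * ‖latticeVec (W₁.phase j).m‖ : ℝ) : ℂ) * Complex.I))‖ +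
             ‖starRingEnd ℂ (Complex.exp ((W₁.phase j).φ * Complex.I)) *
                    (-(1 / (2 * ((2 * Real.pi * ‖latticeVec (W₁.phase j).m‖ : ℝ) : ℂ) * Complex.I)))‖)) := by ring
    rw [h4] at h3
    linarith
  -- Young
  set A : ℝ := ∑ k ∈ W, (‖modeRep W₁ n 𝔹 F u k t‖ * ∑ j, ‖linkCoeff W₁ n k j t‖ *
            (‖Complex.exp ((W₁.phase j).φ * Complex.I) * (1 / (2 * ((2 * Real.pi * ‖latticeVec (W₁.phase j).m‖ : ℝ) : ℂ) * Complex.I))‖ +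
             ‖starRingEnd ℂ (Complex.exp ((W₁.phase j).φ * Complex.I)) *
                    (-(1 / (2 * ((2 * Real.pi * ‖latticeVec (W₁.phase j).m‖ : ℝ) : ℂ) * Complex.I)))‖)) with hA
  have hsq : Real.sqrt Z ^ 2 = Z := Real.sq_sqrt hZnn
  have hyoung : 2 * Real.sqrt Z * A ≤ dmin / 2 * Z + 2 / dmin * A ^ 2 := by
    have h1 : 0 ≤ dmin / 2 * (Real.sqrt Z - 2 / dmin * A) ^ 2 := by positivity
    have h2 : dmin / 2 * (Real.sqrt Z - 2 / dmin * A) ^ 2 = dmin / 2 * Z + 2 / dmin * A ^ 2 - 2 * Real.sqrt Z * A := by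
      rw [sub_sq, hsq]; field_simp; ring
    linarith
  calc ∑ k ∈ W, 2 * (⟪modeRep W₁ n 𝔹 F u k t, (∑ j, linkCoeff W₁ n k j t • transversalProj k
              ((Complex.exp ((W₁.phase j).φ * Complex.I) * (1 / (2 * ((2 * Real.pi * ‖latticeVec (W₁.phase j).m‖ : ℝ) : ℂ) * Complex.I))) •
                  modeRep W₁ n 𝔹 F u (k - fun i => (W₁.phase j).m i * n) t +
                (starRingEnd ℂ (Complex.exp ((W₁.phase j).φ * Complex.I)) *
                    (-(1 / (2 * ((2 * Real.pi * ‖latticeVec (W₁.phase j).m‖ : ℝ) : ℂ) * Complex.I)))) •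
                  modeRep W₁ n 𝔹 F u (k + fun i => (W₁.phase j).m i * n) t))⟫_ℂ).re
      ≤ ∑ k ∈ W, 2 * Real.sqrt Z * (‖modeRep W₁ n 𝔹 F u k t‖ * ∑ j, ‖linkCoeff W₁ n k j t‖ *
            (‖Complex.exp ((W₁.phase j).φ * Complex.I) * (1 / (2 * ((2 * Real.pi * ‖latticeVec (W₁.phase j).m‖ : ℝ) : ℂ) * Complex.I))‖ +
             ‖starRingEnd ℂ (Complex.exp ((W₁.phase j).φ * Complex.I)) *
                    (-(1 / (2 * ((2 * Real.pi * ‖latticeVec (W₁.phase j).m‖ : ℝ) : ℂ) * Complex.I)))‖)) := Finset.sum_le_sum hterm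
    _ = 2 * Real.sqrt Z * A := (Finset.mul_sum _ _ _).symm
    _ ≤ dmin / 2 * Z + 2 / dmin * A ^ 2 := hyoung

/-- **BULK SLAVING OF THE FAST ENERGY.**  With the block's chain neighbours outside the block and the slow-amplitude × link bound
`Σ_{k∈W} ‖y_k(s)‖·Σⱼ‖linkCoeffⱼ(k,s)‖(‖aⱼ‖+‖a′ⱼ‖) ≤ A` on `[0,T]`: for every `t ∈ [0,T]`,
`E t − Σ_{k∈W}‖y_k t‖² ≤ 4A²/dmin² + e^{−dmin·t/2}·((E 0 − Σ_{k∈W}‖y_k 0‖²) − 4A²/dmin²)`.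
[cite: BedrossianCotiZelati2017, §2] [cite: Temam1984, Ch. III §1 Lemma 1.2] -/
theorem fastEnergy_le (W₁ : LatticeWord k₀) (n : ℕ) {T : ℝ} (hT : 0 ≤ T) {𝔹 : Torus.Visc4 (Fin 3)} {lo' hi' : ℝ}
    (h𝔹 : Torus.NearIso 𝔹 lo' hi')
    {F : UnitAddTorus (Fin 3) → EuclideanSpace ℝ (Fin 3)} {u : ℝ → UnitAddTorus (Fin 3) → EuclideanSpace ℝ (Fin 3)}
    (h : Torus.IsWeakTensorPassiveVectorOn 0 T 𝔹 (W₁.cell n) F u) (hF : Integrable F volume)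
    {E Q : ℝ → ℝ} (hE : ∀ᵐ t ∂(volume.restrict (Ioo 0 T)), E t = ∫ x, ‖u t x‖ ^ 2)
    (hQ : ∀ᵐ t ∂(volume.restrict (Ioo 0 T)), ∀ S : Finset (Fin 3 → ℤ),
      4 * Real.pi ^ 2 * ∑ k ∈ S, (⟪mFourierCoeff (EuclideanSpace.complexify ∘ u t) k,
        Torus.symbT 𝔹 k (mFourierCoeff (EuclideanSpace.complexify ∘ u t) k)⟫_ℂ).re ≤ Q t)
    (hEd : ∀ᵐ t ∂(volume : Measure ℝ), t ∈ Ioo 0 T → HasDerivAt E (-(2 * Q t)) t)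
    (hEac : ∀ a ∈ Icc 0 T, ∀ b' ∈ Icc 0 T, AbsolutelyContinuousOnInterval E a b')
    (W : Finset (Fin 3 → ℤ)) {dmin : ℝ} (hdmin : 0 < dmin)
    (hgap : ∀ᵐ t ∂(volume.restrict (Ioo 0 T)), ∀ k : Fin 3 → ℤ, k ∉ W →
      mFourierCoeff (EuclideanSpace.complexify ∘ u t) k ≠ 0 → dmin ≤ 8 * Real.pi ^ 2 * lo' * freqNormSq k)
    (hnb : ∀ k ∈ W, ∀ j : Fin k₀, (k - fun i => (W₁.phase j).m i * n) ∉ W ∧ (k + fun i => (W₁.phase j).m i * n) ∉ W)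
    {A : ℝ} (hA : ∀ s ∈ Icc 0 T, ∑ k ∈ W, (‖modeRep W₁ n 𝔹 F u k s‖ * ∑ j, ‖linkCoeff W₁ n k j s‖ *
            (‖Complex.exp ((W₁.phase j).φ * Complex.I) * (1 / (2 * ((2 * Real.pi * ‖latticeVec (W₁.phase j).m‖ : ℝ) : ℂ) * Complex.I))‖ +
             ‖starRingEnd ℂ (Complex.exp ((W₁.phase j).φ * Complex.I)) *
                    (-(1 / (2 * ((2 * Real.pi * ‖latticeVec (W₁.phase j).m‖ : ℝ) : ℂ) * Complex.I)))‖)) ≤ A)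
    {t : ℝ} (ht : t ∈ Icc 0 T) :
    E t - ∑ k ∈ W, ‖modeRep W₁ n 𝔹 F u k t‖ ^ 2 ≤
      4 * A ^ 2 / dmin ^ 2 + Real.exp (-(dmin / 2 * t)) * ((E 0 - ∑ k ∈ W, ‖modeRep W₁ n 𝔹 F u k 0‖ ^ 2) - 4 * A ^ 2 / dmin ^ 2) := by
  classical
  have hX := ae_exchange_le W₁ n hT h hF hE W hdmin hnb
  have hX' : ∀ᵐ s ∂(volume : Measure ℝ), s ∈ Ioo 0 T →
      ∑ k ∈ W, 2 * (⟪modeRep W₁ n 𝔹 F u k s, (∑ j, linkCoeff W₁ n k j s • transversalProj k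
              ((Complex.exp ((W₁.phase j).φ * Complex.I) * (1 / (2 * ((2 * Real.pi * ‖latticeVec (W₁.phase j).m‖ : ℝ) : ℂ) * Complex.I))) •
                  modeRep W₁ n 𝔹 F u (k - fun i => (W₁.phase j).m i * n) s +
                (starRingEnd ℂ (Complex.exp ((W₁.phase j).φ * Complex.I)) *
                    (-(1 / (2 * ((2 * Real.pi * ‖latticeVec (W₁.phase j).m‖ : ℝ) : ℂ) * Complex.I)))) •
                  modeRep W₁ n 𝔹 F u (k + fun i => (W₁.phase j).m i * n) s))⟫_ℂ).re
        ≤ dmin / 2 * (E s - ∑ k ∈ W, ‖modeRep W₁ n 𝔹 F u k s‖ ^ 2) + 2 / dmin * A ^ 2 := by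
    filter_upwards [hX] with s hs hsI
    have h1 := hs hsI
    have hnn : 0 ≤ ∑ k ∈ W, (‖modeRep W₁ n 𝔹 F u k s‖ * ∑ j, ‖linkCoeff W₁ n k j s‖ *
            (‖Complex.exp ((W₁.phase j).φ * Complex.I) * (1 / (2 * ((2 * Real.pi * ‖latticeVec (W₁.phase j).m‖ : ℝ) : ℂ) * Complex.I))‖ +
             ‖starRingEnd ℂ (Complex.exp ((W₁.phase j).φ * Complex.I)) *
                    (-(1 / (2 * ((2 * Real.pi * ‖latticeVec (W₁.phase j).m‖ : ℝ) : ℂ) * Complex.I)))‖)) :=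
      Finset.sum_nonneg fun k _ => mul_nonneg (norm_nonneg _) (Finset.sum_nonneg fun j _ => by positivity)
    have h2 : (∑ k ∈ W, (‖modeRep W₁ n 𝔹 F u k s‖ * ∑ j, ‖linkCoeff W₁ n k j s‖ *
            (‖Complex.exp ((W₁.phase j).φ * Complex.I) * (1 / (2 * ((2 * Real.pi * ‖latticeVec (W₁.phase j).m‖ : ℝ) : ℂ) * Complex.I))‖ +
             ‖starRingEnd ℂ (Complex.exp ((W₁.phase j).φ * Complex.I)) *
                    (-(1 / (2 * ((2 * Real.pi * ‖latticeVec (W₁.phase j).m‖ : ℝ) : ℂ) * Complex.I)))‖))) ^ 2 ≤ A ^ 2 :=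
      pow_le_pow_left₀ hnn (hA s (Ioo_subset_Icc_self hsI)) 2
    have h3 : 2 / dmin * (∑ k ∈ W, (‖modeRep W₁ n 𝔹 F u k s‖ * ∑ j, ‖linkCoeff W₁ n k j s‖ *
            (‖Complex.exp ((W₁.phase j).φ * Complex.I) * (1 / (2 * ((2 * Real.pi * ‖latticeVec (W₁.phase j).m‖ : ℝ) : ℂ) * Complex.I))‖ +
             ‖starRingEnd ℂ (Complex.exp ((W₁.phase j).φ * Complex.I)) *
                    (-(1 / (2 * ((2 * Real.pi * ‖latticeVec (W₁.phase j).m‖ : ℝ) : ℂ) * Complex.I)))‖))) ^ 2 ≤ 2 / dmin * A ^ 2 :=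
      mul_le_mul_of_nonneg_left h2 (by positivity)
    linarith
  have key := fastEnergy_le_of_exchange_le W₁ n hT h𝔹 h hF hE hQ hEd hEac W hdmin hgap hX' ht
  have h1 : 2 * (2 / dmin * A ^ 2) / dmin = 4 * A ^ 2 / dmin ^ 2 := by field_simp; ring
  rw [h1] at key
  exact key

/-- **Bulk slaving for a datum carried by the block** (`E 0 = Σ_{k∈W}‖y_k 0‖²`, e.g. the single slow mode `Re e_ℓ·p` with `W = {±ℓ}`):
`E t − Σ_{k∈W}‖y_k t‖² ≤ 4A²/dmin²` for all `t ∈ [0,T]` — i.e. `√Z ≤ 2A/dmin`, the ratio (link strength)/(spectral gap), uniformly in time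
and (for the K1L cell problem) in `ν`. [cite: BedrossianCotiZelati2017, §2] [cite: Temam1984, Ch. III §1 Lemma 1.2] -/
theorem fastEnergy_le_of_zero (W₁ : LatticeWord k₀) (n : ℕ) {T : ℝ} (hT : 0 ≤ T) {𝔹 : Torus.Visc4 (Fin 3)} {lo' hi' : ℝ}
    (h𝔹 : Torus.NearIso 𝔹 lo' hi')
    {F : UnitAddTorus (Fin 3) → EuclideanSpace ℝ (Fin 3)} {u : ℝ → UnitAddTorus (Fin 3) → EuclideanSpace ℝ (Fin 3)}
    (h : Torus.IsWeakTensorPassiveVectorOn 0 T 𝔹 (W₁.cell n) F u) (hF : Integrable F volume)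
    {E Q : ℝ → ℝ} (hE : ∀ᵐ t ∂(volume.restrict (Ioo 0 T)), E t = ∫ x, ‖u t x‖ ^ 2)
    (hQ : ∀ᵐ t ∂(volume.restrict (Ioo 0 T)), ∀ S : Finset (Fin 3 → ℤ),
      4 * Real.pi ^ 2 * ∑ k ∈ S, (⟪mFourierCoeff (EuclideanSpace.complexify ∘ u t) k,
        Torus.symbT 𝔹 k (mFourierCoeff (EuclideanSpace.complexify ∘ u t) k)⟫_ℂ).re ≤ Q t)
    (hEd : ∀ᵐ t ∂(volume : Measure ℝ), t ∈ Ioo 0 T → HasDerivAt E (-(2 * Q t)) t)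
    (hEac : ∀ a ∈ Icc 0 T, ∀ b' ∈ Icc 0 T, AbsolutelyContinuousOnInterval E a b')
    (W : Finset (Fin 3 → ℤ)) {dmin : ℝ} (hdmin : 0 < dmin)
    (hgap : ∀ᵐ t ∂(volume.restrict (Ioo 0 T)), ∀ k : Fin 3 → ℤ, k ∉ W →
      mFourierCoeff (EuclideanSpace.complexify ∘ u t) k ≠ 0 → dmin ≤ 8 * Real.pi ^ 2 * lo' * freqNormSq k)
    (hnb : ∀ k ∈ W, ∀ j : Fin k₀, (k - fun i => (W₁.phase j).m i * n) ∉ W ∧ (k + fun i => (W₁.phase j).m i * n) ∉ W)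
    {A : ℝ} (hA : ∀ s ∈ Icc 0 T, ∑ k ∈ W, (‖modeRep W₁ n 𝔹 F u k s‖ * ∑ j, ‖linkCoeff W₁ n k j s‖ *
            (‖Complex.exp ((W₁.phase j).φ * Complex.I) * (1 / (2 * ((2 * Real.pi * ‖latticeVec (W₁.phase j).m‖ : ℝ) : ℂ) * Complex.I))‖ +
             ‖starRingEnd ℂ (Complex.exp ((W₁.phase j).φ * Complex.I)) *
                    (-(1 / (2 * ((2 * Real.pi * ‖latticeVec (W₁.phase j).m‖ : ℝ) : ℂ) * Complex.I)))‖)) ≤ A)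
    (hZ0 : E 0 = ∑ k ∈ W, ‖modeRep W₁ n 𝔹 F u k 0‖ ^ 2)
    {t : ℝ} (ht : t ∈ Icc 0 T) :
    E t - ∑ k ∈ W, ‖modeRep W₁ n 𝔹 F u k t‖ ^ 2 ≤ 4 * A ^ 2 / dmin ^ 2 := by
  have key := fastEnergy_le W₁ n hT h𝔹 h hF hE hQ hEd hEac W hdmin hgap hnb hA ht
  rw [hZ0, sub_self, zero_sub] at key
  have h1 : 0 ≤ Real.exp (-(dmin / 2 * t)) * (4 * A ^ 2 / dmin ^ 2) := by positivity
  linarith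

/-- **A single fast mode is below the fast energy, everywhere on `[0,T]`** (Parseval a.e. + continuity): for `k' ∉ W` and `t ∈ [0,T]`,
`‖y_{k'}(t)‖² ≤ E t − Σ_{k∈W}‖y_k(t)‖²`. [cite: Grafakos2014, Prop. 3.2.7 (3)] -/
theorem norm_sq_le_fastEnergy (W₁ : LatticeWord k₀) (n : ℕ) {T : ℝ} (hT : 0 < T) {𝔹 : Torus.Visc4 (Fin 3)}
    {F : UnitAddTorus (Fin 3) → EuclideanSpace ℝ (Fin 3)} {u : ℝ → UnitAddTorus (Fin 3) → EuclideanSpace ℝ (Fin 3)}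
    (h : Torus.IsWeakTensorPassiveVectorOn 0 T 𝔹 (W₁.cell n) F u) (hF : Integrable F volume)
    {E : ℝ → ℝ} (hEc : ContinuousOn E (Icc 0 T)) (hE : ∀ᵐ t ∂(volume.restrict (Ioo 0 T)), E t = ∫ x, ‖u t x‖ ^ 2)
    (W : Finset (Fin 3 → ℤ)) {k' : Fin 3 → ℤ} (hk' : k' ∉ W) :
    ∀ t ∈ Icc 0 T, ‖modeRep W₁ n 𝔹 F u k' t‖ ^ 2 ≤ E t - ∑ k ∈ W, ‖modeRep W₁ n 𝔹 F u k t‖ ^ 2 := by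
  classical
  have hcont : ∀ k, ContinuousOn (fun t => ‖modeRep W₁ n 𝔹 F u k t‖ ^ 2) (Icc 0 T) :=
    fun k => ((continuousOn_modeRep W₁ n hT.le h k).norm).pow 2
  refine le_on_Icc_of_ae_le hT (hcont k') (hEc.sub (continuousOn_finsetSum W fun k _ => hcont k)) ?_
  filter_upwards [ae_forall_eq_modeRep W₁ n hT.le h hF, hE, h.ae_memLp_two] with t hrept hEt hmemt
  have hpars : HasSum (fun k => ‖modeRep W₁ n 𝔹 F u k t‖ ^ 2) (E t) := by
    have hp := hasSum_sq_norm_mFourierCoeff_complexify hmemt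
    rw [hEt]
    refine hp.congr_fun fun k => ?_
    simp only [hrept k]
  have h1 := sum_le_hasSum (insert k' W) (fun i _ => sq_nonneg ‖modeRep W₁ n 𝔹 F u i t‖) hpars
  rw [Finset.sum_insert hk'] at h1
  linarith

end Summit.AnomalousDissipation.AnomalousDissipation.Theorems.SolenoidalFractalHomogenisation.LagrangianStep.CellChain

end
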